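import Summits.CriticalPhenomena.PercolationContinuityZ3.Theorems.Transplant.SkelConcRootRun
import Summits.CriticalPhenomena.PercolationContinuityZ3.Theorems.Transplant.SkelConcSchedule
import HarnessLib

/-!
# L6 (R), file 4: the STANDARD root run in narrow form and the ROOT RADIUS FACTS of the schedule of record `Skel.concRadiiS` — the planar
# numerics `RootRunOKN` at the product's standard parameters (`ca = 26t − m − 1`, `cb = 0`, `q' = 3t`; the narrow clause `htrN` has slack
# `15t − 47R' − 1`), and, with `Rt + 1 := F 1 − L'`, the three radius facts of `Skel.rootOblA_of_rootRunSG` with their unit of slack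
# (`rB 0 0 du = E 1`, `rQ 0 (0+du) = E 1 ⊔ off`, `rM 0 (0+du) = F 1 − L'`) plus `rQ 0 0 = E₀ ⊔ 1 ≤ E₀` — narrow twin of
# `KNCellsBoxProdZ2ConcRootGB.rootRunOK_std` (its nine inequalities re-proved inline to keep the product (R) chain out of the import closure) + `KNCellsBoxProdZ2ConcRootReal.root_radii_concRadiiGB`

builds on p205010 (kernel theorem, internal audit signed; external expert review pending) — nothing in this file uses p205010.
Status sentence (coordinator 2026-08-20T04:30Z): "θ(p_c) = 0 on ℤ^d, all d ≥ 2 — kernel-verified (Lean 4/Mathlib, standard axioms); internal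
adversarial audit SIGNED 2026-08-20 04:29Z; external expert review pending."
Lane `prim-bschramm-*`, seat `prim-bschramm-p2` (gen 4; (R) = p2 lineage, SHEAR-SCOPE §3.9 Layer 6); helper file (`--supports stmt-CriticalPhenomena-4575`).

* **`BoxProdZ2.rootRunOKN_std`** — `r = 4t`, `R' + ℓ₀ ≤ t`, `100 R' ≤ t`, `m + 47 R' + 2 ≤ t` ⟹ `RootRunOKN C t R' ℓ₀ (26t − m − 1) 0 (3t)`;
* **`Skel.root_radii_concRadiiS`** — for `Λ := Skel.concRadiiS C gap gap' E₀ L'`, `1 ≤ E₀`, every `du`: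
  `F 1 − L' ≤ rB 0 0 du`, `F 1 − L' ≤ rQ 0 (0 + du)`, `F 1 − L' ≤ rM 0 (0 + du)`, `rQ 0 0 ≤ E₀` (the consumer takes `Rt := F 1 − L' − 1`).
[cite: KozmaNitzan2024, §4 p. 28 ((32) at the root), Lemma 11 (pp. 22–23)]
-/

noncomputable section

open scoped Classical

namespace Summit.CriticalPhenomena.PercolationContinuityZ3.Theorems

namespace Transplant

/-! ## §1 The standard root run, narrow form -/

namespace BoxProdZ2

open Literature.Probability.Percolation Literature.Probability.LatticeModels

/-- **The standard root run is admissible in narrow form**: `ca = 26t − m − 1`, `cb = 0`, `q' = 3t`; the narrow clause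
`|0| + 3t + 2t + 47R' + 1 ≤ 20t` holds with slack `15t − 47R' − 1 ≥ 0` (`100 R' ≤ t`, `t ≥ 2`). [folklore] -/
theorem rootRunOKN_std {C : PCells} {t R' ℓ₀ m : ℕ} (hr : (C.r : ℤ) = 4 * t) (hs : (R' : ℤ) + ℓ₀ ≤ t) (h100 : 100 * R' ≤ t)
    (hm : m + 47 * R' + 2 ≤ t) : RootRunOKN C t R' ℓ₀ (26 * (t : ℤ) - m - 1) 0 (3 * (t : ℤ)) := by
  have h100' : 100 * (R' : ℤ) ≤ t := by exact_mod_cast h100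
  have hm' : (m : ℤ) + 47 * R' + 2 ≤ t := by exact_mod_cast hm
  have hR0 : (0 : ℤ) ≤ R' := by positivity
  have hm0 : (0 : ℤ) ≤ m := by positivity
  exact ⟨⟨hr, hs, by linarith, by positivity, by linarith, by linarith, by linarith, by simp; linarith, by simp; linarith⟩, by simp; linarith⟩

end BoxProdZ2

/-! ## §2 The root radius facts of `Skel.concRadiiS` -/

namespace Skel

open Literature.Probability.Percolation Literature.Probability.LatticeModels SimpleGraph
open BoxProdZ2 (ConcRadiiG Erad Frad nQ nS Frad_le_Erad Erad_zero gen0_zero gen0_stepVec)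

variable (C : PCells) (gap gap' : ℕ → ℕ) (E₀ L' : ℕ)

/-- `nQ 0 (0 + du) = 1`. [folklore] -/
theorem nQ_zero_stepVec (du : MDir) : nQ 0 ((0 : Site 2) + stepVec du) = 1 := by
  rw [zero_add, nQ, if_pos rfl, gen0_stepVec]

/-- `nQ 0 0 = 0`. [folklore] -/
theorem nQ_zero_zero : nQ 0 (0 : Site 2) = 0 := by rw [nQ, if_pos rfl, gen0_zero]

/-- `off C 0 = 1` (the macro-origin has no planar offset). [folklore] -/
theorem off_zero : off C 0 = 1 := by simp [off, PCells.cen_apply]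

/-- **The root radius facts of the schedule of record** (`1 ≤ E₀`): `F 1 − L' ≤ rB 0 0 du`, `F 1 − L' ≤ rQ 0 (0 + du)`, `F 1 − L' ≤ rM 0 (0 + du)`
and `rQ 0 0 ≤ E₀`. [cite: KozmaNitzan2024, §4 p. 28] -/
theorem root_radii_concRadiiS (hE₀ : 1 ≤ E₀) (du : MDir) :
    Frad gap gap' E₀ 1 - L' ≤ (concRadiiS C gap gap' E₀ L').rB 0 0 du ∧
      Frad gap gap' E₀ 1 - L' ≤ (concRadiiS C gap gap' E₀ L').rQ 0 ((0 : Site 2) + stepVec du) ∧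
      Frad gap gap' E₀ 1 - L' ≤ (concRadiiS C gap gap' E₀ L').rM 0 ((0 : Site 2) + stepVec du) ∧
      (concRadiiS C gap gap' E₀ L').rQ 0 0 ≤ E₀ := by
  refine ⟨?_, ?_, ?_, ?_⟩
  · rw [concRadiiS_rB, nQ_zero_stepVec]
    exact (Nat.sub_le _ _).trans (Frad_le_Erad gap gap' E₀ 1)
  · rw [concRadiiS_rQ, nQ_zero_stepVec]
    exact le_max_of_le_left ((Nat.sub_le _ _).trans (Frad_le_Erad gap gap' E₀ 1))
  · rw [concRadiiS_rM, nQ_zero_stepVec]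
  · rw [concRadiiS_rQ, nQ_zero_zero, Erad_zero, off_zero]
    exact max_le le_rfl hE₀

/-- **The same in the consumer's shape** (`Skel.rootOblA_of_rootRunSG`): with `Rt := F 1 − L' − 1` and `L' + 1 ≤ F 1`, the three radius
facts with their unit of slack. [folklore] -/
theorem root_radii_concRadiiS' (hE₀ : 1 ≤ E₀) (hL : L' + 1 ≤ Frad gap gap' E₀ 1) (du : MDir) :
    (Frad gap gap' E₀ 1 - L' - 1) + 1 ≤ (concRadiiS C gap gap' E₀ L').rB 0 0 du ∧
      (Frad gap gap' E₀ 1 - L' - 1) + 1 ≤ (concRadiiS C gap gap' E₀ L').rQ 0 ((0 : Site 2) + stepVec du) ∧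
      (Frad gap gap' E₀ 1 - L' - 1) + 1 ≤ (concRadiiS C gap gap' E₀ L').rM 0 ((0 : Site 2) + stepVec du) := by
  obtain ⟨h1, h2, h3, -⟩ := root_radii_concRadiiS C gap gap' E₀ L' hE₀ du
  have h : Frad gap gap' E₀ 1 - L' - 1 + 1 = Frad gap gap' E₀ 1 - L' := by omega
  rw [h]
  exact ⟨h1, h2, h3⟩

end Skel

end Transplant

end Summit.CriticalPhenomena.PercolationContinuityZ3.Theorems

end
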